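import Summits.ABC.ABC.Theses.FeketeScales
import Summits.ABC.ABC.Theorems.FeketeScalesSubmultOfRST
import Summits.ABC.ABC.Theorems.FeketeScalesSubmultOfRSTBridge
import Summits.ABC.ABC.Theorems.FeketeScalesScaleSubmultiplicativityOfEnvelopeOfPowerShapes
import Summits.ABC.ABC.Theorems.ScaleSubmultiplicativity.Negative.SmallScales

/-!
# Disproof workfile — crux stmt-ABC-2160 `Summit.ABC.ABC.Theses.FeketeScales.ScaleSubmultiplicativity`

Standing disprover refuter-cdisprove-stmt-ABC-2160-0, cycle 1 (2026-08-16).  Findings, indexed: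

* **VERDICT SO FAR: no kill, and none is available with present knowledge.**  §2 makes this precise in
  the kernel: any refutation of the crux refutes Robert–Stewart–Tenenbaum's Conjecture A (upper half).
* §1 READ-BACK (probe `W.lean`, rc 0): the body is `c ≤ K · exp((log (R₁R₂))^θ) · c₁ · c₂` with `^` the real
  power OF THE LOGARITHM (checked by `Iff.rfl` against the `HPow.hPow (Real.log _) θ` spelling; it is NOT
  `log((R₁R₂)^θ)`, which would be the `(R₁R₂)^θ`-slack).  Casts ℕ→ℝ only; no ℕ-subtraction, no division, no
  `sSup`/`tsum`; `IsABCTriple` is symmetric (`0<a ∧ 0<b ∧ a+b=c ∧ coprime`), so `(1,1,2)` (rad 2) is a triple and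
  shadows exist at every scale `≥ 2`.  Quantifier order = the informal text (∃θ<1 ∃K ∃R₀ ∀R₁,R₂≥R₀ ∀T ∃T₁,T₂).
* §2 WHY IT RESISTS (theorems `bursts_of_not`, `not_rstConjectureAUpper_of_not`): `¬crux` forces, for every
  `τ < 1` and every `A`, an abc triple with `c ≥ rad·exp(A (log rad)^τ)` — super-RST bursts of every sub-power
  order — because the landed support item `submultOfRST_proof` is "no bursts ⟹ crux"; composing with the landed
  bridge, `¬crux → ¬RSTConjectureAUpper`.  Every PROVED burst family (Stewart–Tijdeman / van Frankenhuijsen /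
  Bright, `Literature.Barriers.ABC.EpsilonCannotBeDropped_holds`) has excess `≍ √(log rad)/log log rad`, below
  `(log rad)^{1/2}`.  The other half of a refutation is worse: `¬crux` is `∀ R₀ ∃ R₁ R₂ ≥ R₀ …`, so the refuter
  must bound the record heights `G(R₁)·G(R₂)` FROM ABOVE at two unbounded scales (certify good scales); the only
  unconditional upper bound is Stewart–Yu `log G(R) ≪ R^{1/3} log³R`.  Finite tables refute nothing (R₀ is ∃).
* §3 LOAD-BEARING HYPOTHESES.  `R₀`: `false_without_R0` — with `R₀ := 1` forced the statement is false
  (scale 1 carries no shadow since `rad ≥ 2`); and small scales are violently SUPER-multiplicative: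
  `G(R) = 9` for `6 ≤ R ≤ 29` while `G(27·27) ≥ 6561 = 81·G(27)²` via `(289, 6272, 6561)`, rad `714`
  (certified small model, §4; so `R₀ ≤ 27` forces `K e^{(log 729)^θ} ≥ 81`, and the census maximum
  `K(R₀ ≤ 10, θ = 0) = 163.5` is Reyssat against `G(22) = 9`, `G(684) = 4375`).  `θ < 1`: NOT load-bearing for
  provability — for every real `θ` (also `θ ≥ 1`) the statement stays open, since by the Fekete iteration plus one
  scale it yields `log c ≪ (log rad)^{max(θ,1)+o(1)}`, far beyond Stewart–Yu; the first unconditional rung is the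
  Stewart–Yu slack `exp(κ R^{1/3} log³ R)` (landed `ScaleSubmultiplicativity.stewartYu_slack_submult`).
  `0 < K`: cosmetic.
* §4 SMALL MODELS (certified and LANDED: `Theorems/ScaleSubmultiplicativity/Negative/TwoPrimeShapes.lean`,
  `…/Negative/SmallScales.lean`, imported here; section §4 below re-exports the two headline facts):
  every abc triple with `rad ≤ 29` has `c ≤ 9` (`ScaleSubmultiplicativity.c_le_nine_of_rad_le`: even squarefree
  radical `≤ 29` is `2` or `2p`, `p ≤ 13`; shape lemma + congruences mod 16/8/5/3 — Levi ben Gerson for `{2,3}`),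
  attained by `1+8=9` (`nine_attained`); `(289,6272,6561)` has rad `714` (`rad_289_6272_6561`); corollaries:
  `supermultiplicative_at_27` (`G(729) ≥ 81·G(27)²`), `constant_ge_81_of_threshold_le_27` (`R₀ ≤ 27 ⟹
  K e^{(log 729)^θ} ≥ 81`), `record_jump_at_30` (`G(30) ≥ 128 > 14·G(29)`: a threshold-free "left-continuity" form
  with slack `e^{√log R}` is false), and TIGHTNESS `exists_triple_at_scale_not_three` (the `4` in
  `SubmultOfRST.exists_triple_at_scale`, `R < 4c`, cannot be `3`).
* §5 LINE SketchIdeator3 (picked; lead prover-line-stmt-ABC-2160-0).  Stubs S1–S4 are landed theorems (true; my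
  paper check of S2/S4: `gcd(x^d−y^d, x^d+y^d) ∣ 2`, `gcd(z−x, Φ_n) ∣ n` — fine).  Open stubs: (P)
  `primitive_subpower_envelope`, (W) `powerShape_submult`.  Both are implied by `RSTConjectureAUpper`
  (`stubP_of_subpowerSlack`, `stubW_of_scaleSubmultiplicativity` below), hence as unrefutable as the crux; (P) is
  pointwise, so finite tables cannot touch it either (`B` absorbs any finite set).  NATURAL STRENGTHENING of (P)
  that IS false: `θ < 1/2` — killed by the Stewart–Tijdeman pigeonhole families PROVIDED infinitely many of them are
  not power-shaped (generically true: `a`, `c` odd `y`-smooth, `b = 2^k b'`; but `EpsilonCannotBeDropped` records no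
  shape), near-miss `not_stubP_lt_half` (sorry, obstruction in its docstring).  Joint sufficiency S1+S5+S6 ⟹ crux:
  kernel-checked by the lead (`ScaleSubmultiplicativity.of_primitiveEnvelope_of_powerShapeSubmult`); no gap, no
  stub misstated.  Advice to the lead (from §2–§3): (P) is RST-lite — ABC-strength on a co-thin set with a
  quasi-explicit constant (`stubP_imp_abc_on_primitive` below) — do not expect movement; the informative work is the
  census (BarrierNotesIdeator3 §C) and conditional corollaries.
-/

-- `Summit.<Summit>.<Problem>` is the mandated summit-side namespace (CONVENTIONS §2).
set_option linter.dupNamespace false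

namespace Summit.ABC.ABC.Cruxes.ScaleSubmultiplicativity.Disproof

open Literature.NumberTheory.DiophantineGeometry
open Summit.ABC.ABC.Theses.FeketeScales
open Summit.ABC.ABC.Theorems

/-! ## §2  Why it resists: a refutation needs super-RST bursts -/

/-- **Bursts are necessary.**  If `ScaleSubmultiplicativity` fails then for every `τ < 1` and every real
`A` some abc triple has `c ≥ rad · exp(A (log rad)^τ)` — the contrapositive of the landed support item
`submultOfRST_proof` (stmt-ABC-10340, "pointwise sub-power slack ⟹ crux"). [folklore] -/
theorem bursts_of_not (h : ¬ ScaleSubmultiplicativity) (τ : ℝ) (hτ : τ < 1) (A : ℝ) :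
    ∃ a b c : ℕ, IsABCTriple a b c ∧
      ((rad a b c : ℕ) : ℝ) * Real.exp (A * Real.log ((rad a b c : ℕ) : ℝ) ^ τ) ≤ (c : ℝ) := by
  by_contra hcon
  push Not at hcon
  have hS : SubmultOfRST := submultOfRST_proof
  exact h (hS ⟨τ, hτ, A, hcon⟩)

/-- **Any refutation of the crux refutes RST Conjecture A (upper half).**  By the landed bridge
`SubmultOfRST.scaleSubmultiplicativity_of_rstConjectureAUpper`.
[cite: RobertStewartTenenbaum2014, Conjecture A (1.5), §1 p. 1157] -/
theorem not_rstConjectureAUpper_of_not (h : ¬ ScaleSubmultiplicativity) :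
    ¬ Literature.Barriers.ABC.RSTConjectureAUpper :=
  fun hR => h (SubmultOfRST.scaleSubmultiplicativity_of_rstConjectureAUpper hR)

/-! ## §3  Load-bearing hypotheses -/

/-- The crux with the threshold `R₀` removed (all scales `R₁, R₂ ≥ 1`). -/
def WithoutR0 : Prop :=
  ∃ θ : ℝ, θ < 1 ∧ ∃ K : ℝ, 0 < K ∧ ∀ R₁ R₂ : ℕ, 1 ≤ R₁ → 1 ≤ R₂ → ∀ a b c : ℕ,
    IsABCTriple a b c → rad a b c ≤ R₁ * R₂ → ∃ a₁ b₁ c₁ a₂ b₂ c₂ : ℕ, IsABCTriple a₁ b₁ c₁ ∧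
      rad a₁ b₁ c₁ ≤ R₁ ∧ IsABCTriple a₂ b₂ c₂ ∧ rad a₂ b₂ c₂ ≤ R₂ ∧
      (c : ℝ) ≤ K * Real.exp (Real.log ((R₁ : ℝ) * R₂) ^ θ) * c₁ * c₂

/-- `(1, 1, 2)` is an abc triple (the definition is symmetric in `a`, `b`). [folklore] -/
theorem isABCTriple_one_one_two : IsABCTriple 1 1 2 :=
  ⟨Nat.one_pos, Nat.one_pos, rfl, Nat.coprime_one_left 1⟩

/-- `rad(1·1·2) = 2`. [folklore] -/
theorem rad_one_one_two : rad 1 1 2 = 2 := by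
  rw [rad_def, UniqueFactorizationMonoid.radical_of_prime (Nat.prime_iff.mp Nat.prime_two)]
  simp

/-- **`R₀` is load-bearing**: with `R₀ := 1` the statement is false, because the triple `(1,1,2)`
(rad `2 ≤ 1·2`) would need a shadow of radical `≤ 1`, and every abc triple has `rad ≥ 2`. [folklore] -/
theorem false_without_R0 : ¬ WithoutR0 := by
  rintro ⟨θ, -, K, -, h⟩
  obtain ⟨a₁, b₁, c₁, _a₂, _b₂, _c₂, h₁, hr₁, -, -, -⟩ :=
    h 1 2 le_rfl one_le_two 1 1 2 isABCTriple_one_one_two (by rw [rad_one_one_two])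
  have := SubmultOfRST.two_le_rad h₁
  omega

/-! ## §4  Small models (landed under `Theorems/ScaleSubmultiplicativity/Negative/`) -/

/-- Re-export: the crux's inequality cannot be witnessed with threshold `R₀ ≤ 27` unless
`K · exp((log 729)^θ) ≥ 81` (`G ≡ 9` on `[6,29]` against `(289, 6272, 6561)` at the split `(27,27)`). [folklore] -/
theorem threshold_le_27_forces_constant {θ K : ℝ} {R₀ : ℕ} (hR₀ : R₀ ≤ 27)
    (h : ∀ R₁ R₂ : ℕ, R₀ ≤ R₁ → R₀ ≤ R₂ → ∀ a b c : ℕ, IsABCTriple a b c → rad a b c ≤ R₁ * R₂ →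
      ∃ a₁ b₁ c₁ a₂ b₂ c₂ : ℕ, IsABCTriple a₁ b₁ c₁ ∧ rad a₁ b₁ c₁ ≤ R₁ ∧ IsABCTriple a₂ b₂ c₂ ∧
        rad a₂ b₂ c₂ ≤ R₂ ∧ (c : ℝ) ≤ K * Real.exp (Real.log ((R₁ : ℝ) * R₂) ^ θ) * c₁ * c₂) :
    81 ≤ K * Real.exp (Real.log 729 ^ θ) :=
  ScaleSubmultiplicativity.constant_ge_81_of_threshold_le_27 hR₀ h

/-- Re-export: `G(R) = 9` for `6 ≤ R ≤ 29` — every abc triple of radical `≤ 29` has `c ≤ 9`, and `1 + 8 = 9`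
has radical `6`. [folklore] -/
theorem records_frozen_below_30 :
    (∀ a b c : ℕ, IsABCTriple a b c → rad a b c ≤ 29 → c ≤ 9) ∧ (IsABCTriple 1 8 9 ∧ rad 1 8 9 = 6) :=
  ⟨fun _ _ _ h hr => ScaleSubmultiplicativity.c_le_nine_of_rad_le h hr, ScaleSubmultiplicativity.nine_attained⟩

/-! ## §5  Line SketchIdeator3: the open stubs (P), (W) sit below RST Conjecture A -/

/-- Stub (P) of the picked line, verbatim (`ScaleSubmultiplicativity.primitive_subpower_envelope`). -/
def StubP : Prop :=
  ∃ θ : ℝ, 0 ≤ θ ∧ θ < 1 ∧ ∃ B : ℝ, ∀ a b c : ℕ, IsABCTriple a b c →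
    ¬ (∃ j : ℕ, 2 ≤ j ∧ ((∃ x y : ℕ, a = x ^ j ∧ b = y ^ j) ∨ (∃ x z : ℕ, a = x ^ j ∧ c = z ^ j) ∨
        (∃ y z : ℕ, b = y ^ j ∧ c = z ^ j))) →
    (c : ℝ) ≤ Real.exp B * (rad a b c : ℝ) * Real.exp (Real.log (rad a b c : ℝ) ^ θ)

/-- Stub (W) of the picked line, verbatim (`ScaleSubmultiplicativity.powerShape_submult`). -/
def StubW : Prop :=
  ∃ θ : ℝ, 0 ≤ θ ∧ θ < 1 ∧ ∃ K : ℝ, 0 < K ∧ ∃ R₀ : ℕ, ∀ R₁ R₂ : ℕ, R₀ ≤ R₁ → R₀ ≤ R₂ →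
    ∀ a b c : ℕ, IsABCTriple a b c →
    (∃ j : ℕ, 2 ≤ j ∧ ((∃ x y : ℕ, a = x ^ j ∧ b = y ^ j) ∨ (∃ x z : ℕ, a = x ^ j ∧ c = z ^ j) ∨
        (∃ y z : ℕ, b = y ^ j ∧ c = z ^ j))) →
    rad a b c ≤ R₁ * R₂ →
    ∃ a₁ b₁ c₁ a₂ b₂ c₂ : ℕ, IsABCTriple a₁ b₁ c₁ ∧ rad a₁ b₁ c₁ ≤ R₁ ∧ IsABCTriple a₂ b₂ c₂ ∧
      rad a₂ b₂ c₂ ≤ R₂ ∧ (c : ℝ) ≤ K * Real.exp (Real.log ((R₁ : ℝ) * R₂) ^ θ) * c₁ * c₂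

/-- (W) follows from the crux itself with `θ⁺ = max θ 0` (monotonicity of the slack in `θ`, `bound_mono`),
hence from `RSTConjectureAUpper`; so (W) is exactly as unrefutable as the crux. [folklore] -/
theorem stubW_of_scaleSubmultiplicativity (h : ScaleSubmultiplicativity) : StubW := by
  obtain ⟨θ, hθ1, K, hK, R₀, hS⟩ := h
  refine ⟨max θ 0, le_max_right _ _, max_lt hθ1 one_pos, K, hK, max R₀ 4, ?_⟩
  intro R₁ R₂ hR₁ hR₂ a b c habc _hps hrad
  obtain ⟨a₁, b₁, c₁, a₂, b₂, c₂, h₁, hr₁, h₂, hr₂, hle⟩ :=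
    hS R₁ R₂ ((le_max_left _ _).trans hR₁) ((le_max_left _ _).trans hR₂) a b c habc hrad
  have hR3 : 3 ≤ R₁ * R₂ :=
    calc 3 ≤ 4 * 4 := by norm_num
      _ ≤ R₁ * R₂ := Nat.mul_le_mul ((le_max_right _ _).trans hR₁) ((le_max_right _ _).trans hR₂)
  exact ⟨a₁, b₁, c₁, a₂, b₂, c₂, h₁, hr₁, h₂, hr₂,
    ScaleSubmultiplicativity.bound_mono (le_max_left _ _) le_rfl hK.le hR3 hle⟩

/-- (W) below RST Conjecture A (upper half). [cite: RobertStewartTenenbaum2014, Conjecture A (1.5), §1 p. 1157] -/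
theorem stubW_of_rstConjectureAUpper (h : Literature.Barriers.ABC.RSTConjectureAUpper) : StubW :=
  stubW_of_scaleSubmultiplicativity (SubmultOfRST.scaleSubmultiplicativity_of_rstConjectureAUpper h)

/-- (P) follows from the pointwise sub-power slack for ALL triples (hypothesis of `SubmultOfRST`), with
`θ := (1 + max τ 0)/2` and an explicit `B` (threshold argument of `submultOfRST_proof`, pointwise: below the
threshold `N₀` the slack is at most `|A| max(1,(log 2)^τ) (log N₀)^{τ⁺}`, no finiteness needed); hence (P) follows
from `RSTConjectureAUpper`.  So (P), too, cannot be refuted without refuting RST-A. [folklore] -/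
theorem stubP_of_subpowerSlack
    (h : ∃ τ : ℝ, τ < 1 ∧ ∃ A : ℝ, ∀ a b c : ℕ, IsABCTriple a b c →
      (c : ℝ) < ((rad a b c : ℕ) : ℝ) * Real.exp (A * Real.log ((rad a b c : ℕ) : ℝ) ^ τ)) :
    StubP := by
  obtain ⟨τ, hτ1, A, hA⟩ := h
  set t : ℝ := max τ 0 with ht_def
  have ht0 : 0 ≤ t := le_max_right _ _
  have ht1 : t < 1 := max_lt hτ1 one_pos
  set B : ℝ := |A| * max 1 (Real.log 2 ^ τ) with hB_def
  set s : ℝ := (1 - t) / 2 with hs_def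
  have hs : 0 < s := by rw [hs_def]; linarith
  obtain ⟨N₀, hN₀⟩ := SubmultOfRST.exists_threshold B hs
  set B' : ℝ := max (B * Real.log (N₀ : ℝ) ^ t) 0 with hB'_def
  have hB'0 : 0 ≤ B' := le_max_right _ _
  refine ⟨(1 + t) / 2, by linarith, by linarith, B', ?_⟩
  intro a b c habc _hps
  have hrad2 : (2 : ℝ) ≤ ((rad a b c : ℕ) : ℝ) := by exact_mod_cast SubmultOfRST.two_le_rad habc
  have hrad0 : (0 : ℝ) ≤ ((rad a b c : ℕ) : ℝ) := Nat.cast_nonneg _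
  have hlog0 : 0 ≤ Real.log ((rad a b c : ℕ) : ℝ) := Real.log_nonneg (by linarith)
  have hθ0 : 0 ≤ Real.log ((rad a b c : ℕ) : ℝ) ^ ((1 + t) / 2) := Real.rpow_nonneg hlog0 _
  -- the exponent bound `A (log rad)^τ ≤ B' + (log rad)^θ`
  have hexp : A * Real.log ((rad a b c : ℕ) : ℝ) ^ τ ≤ B' + Real.log ((rad a b c : ℕ) : ℝ) ^ ((1 + t) / 2) := by
    rcases le_or_gt N₀ (rad a b c) with hN | hN
    · calc A * Real.log ((rad a b c : ℕ) : ℝ) ^ τ ≤ B * Real.log ((rad a b c : ℕ) : ℝ) ^ t :=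
            SubmultOfRST.slack_le habc le_rfl
        _ ≤ Real.log ((rad a b c : ℕ) : ℝ) ^ s * Real.log ((rad a b c : ℕ) : ℝ) ^ t :=
            mul_le_mul_of_nonneg_right (hN₀ _ hN) (Real.rpow_nonneg hlog0 t)
        _ = Real.log ((rad a b c : ℕ) : ℝ) ^ (s + t) := (Real.rpow_add_of_nonneg hlog0 hs.le ht0).symm
        _ = Real.log ((rad a b c : ℕ) : ℝ) ^ ((1 + t) / 2) := by rw [hs_def]; ring_nf
        _ ≤ B' + Real.log ((rad a b c : ℕ) : ℝ) ^ ((1 + t) / 2) := le_add_of_nonneg_left hB'0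
    · calc A * Real.log ((rad a b c : ℕ) : ℝ) ^ τ ≤ B * Real.log (N₀ : ℝ) ^ t :=
            SubmultOfRST.slack_le habc hN.le
        _ ≤ B' := le_max_left _ _
        _ ≤ B' + Real.log ((rad a b c : ℕ) : ℝ) ^ ((1 + t) / 2) := le_add_of_nonneg_right hθ0
  calc (c : ℝ) ≤ ((rad a b c : ℕ) : ℝ) * Real.exp (A * Real.log ((rad a b c : ℕ) : ℝ) ^ τ) :=
        (hA a b c habc).le
    _ ≤ ((rad a b c : ℕ) : ℝ) * Real.exp (B' + Real.log ((rad a b c : ℕ) : ℝ) ^ ((1 + t) / 2)) :=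
        mul_le_mul_of_nonneg_left (Real.exp_le_exp.mpr hexp) hrad0
    _ = Real.exp B' * ((rad a b c : ℕ) : ℝ) * Real.exp (Real.log ((rad a b c : ℕ) : ℝ) ^ ((1 + t) / 2)) := by
        rw [Real.exp_add]; ring

/-- (P) below RST Conjecture A (upper half). [cite: RobertStewartTenenbaum2014, Conjecture A (1.5), §1 p. 1157] -/
theorem stubP_of_rstConjectureAUpper (h : Literature.Barriers.ABC.RSTConjectureAUpper) : StubP :=
  stubP_of_subpowerSlack (SubmultOfRST.subpowerSlack_of_rstConjectureAUpper h)

/-- **(P) is abc-strength on the primitive (non-power-shaped) triples.**  Stub (P) implies, for every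
`ε > 0`, a constant `C` with `c < C · rad^{1+ε}` for every abc triple NOT of power shape: `(log rad)^θ ≤ ε log rad`
above the threshold where `(log rad)^{1-θ} ≥ 1/ε`, and `exp((log rad)^θ) ≤ exp((log N₀)^θ)` below it.  So a proof
of (P) proves the abc conjecture on a co-thin set of triples with a quasi-explicit constant — the stub is not a
"residual", it is RST-lite (cf. BarrierNotesIdeator3 §A6). [folklore] -/
theorem abcOnPrimitive_of_stubP (h : StubP) :
    ∀ ε : ℝ, 0 < ε → ∃ C : ℝ, 0 < C ∧ ∀ a b c : ℕ, IsABCTriple a b c →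
      ¬ (∃ j : ℕ, 2 ≤ j ∧ ((∃ x y : ℕ, a = x ^ j ∧ b = y ^ j) ∨ (∃ x z : ℕ, a = x ^ j ∧ c = z ^ j) ∨
          (∃ y z : ℕ, b = y ^ j ∧ c = z ^ j))) →
      (c : ℝ) < C * ((rad a b c : ℕ) : ℝ) ^ (1 + ε) := by
  obtain ⟨θ, hθ0, hθ1, B, hP⟩ := h
  intro ε hε
  have hs : 0 < 1 - θ := by linarith
  obtain ⟨N₀, hN₀⟩ := SubmultOfRST.exists_threshold (1 / ε) hs
  set N₁ : ℕ := max N₀ 2 with hN₁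
  have hN₁2 : (2 : ℝ) ≤ (N₁ : ℝ) := by exact_mod_cast le_max_right _ _
  have hlogN₁ : 0 ≤ Real.log (N₁ : ℝ) := Real.log_nonneg (by linarith)
  refine ⟨Real.exp B * (Real.exp (Real.log (N₁ : ℝ) ^ θ) + 1), by positivity, ?_⟩
  intro a b c habc hps
  have hc := hP a b c habc hps
  have hrad2 : (2 : ℝ) ≤ ((rad a b c : ℕ) : ℝ) := by exact_mod_cast SubmultOfRST.two_le_rad habc
  have hrad0 : (0 : ℝ) < ((rad a b c : ℕ) : ℝ) := by linarith
  have hrad1 : (1 : ℝ) ≤ ((rad a b c : ℕ) : ℝ) := by linarith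
  have hlog0 : 0 ≤ Real.log ((rad a b c : ℕ) : ℝ) := Real.log_nonneg hrad1
  have hpow1 : ((rad a b c : ℕ) : ℝ) ≤ ((rad a b c : ℕ) : ℝ) ^ (1 + ε) := by
    calc ((rad a b c : ℕ) : ℝ) = ((rad a b c : ℕ) : ℝ) ^ (1 : ℝ) := (Real.rpow_one _).symm
      _ ≤ ((rad a b c : ℕ) : ℝ) ^ (1 + ε) := Real.rpow_le_rpow_of_exponent_le hrad1 (by linarith)
  have hpowpos : 0 < ((rad a b c : ℕ) : ℝ) ^ (1 + ε) := Real.rpow_pos_of_pos hrad0 _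
  have hEB : 0 < Real.exp B := Real.exp_pos B
  rcases le_or_gt N₁ (rad a b c) with hN | hN
  · -- large radical: `(log rad)^θ ≤ ε log rad`
    have hthr : 1 / ε ≤ Real.log ((rad a b c : ℕ) : ℝ) ^ (1 - θ) := hN₀ _ ((le_max_left _ _).trans hN)
    have hθle : Real.log ((rad a b c : ℕ) : ℝ) ^ θ ≤ ε * Real.log ((rad a b c : ℕ) : ℝ) := by
      have e1 : ε * Real.log ((rad a b c : ℕ) : ℝ)
          = ε * Real.log ((rad a b c : ℕ) : ℝ) ^ (1 - θ) * Real.log ((rad a b c : ℕ) : ℝ) ^ θ := by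
        rw [mul_assoc, ← Real.rpow_add_of_nonneg hlog0 hs.le hθ0]; norm_num
      rw [e1]
      have h1 : (1 : ℝ) ≤ ε * Real.log ((rad a b c : ℕ) : ℝ) ^ (1 - θ) := by
        rw [div_le_iff₀ hε, mul_comm] at hthr; exact hthr
      calc Real.log ((rad a b c : ℕ) : ℝ) ^ θ = 1 * Real.log ((rad a b c : ℕ) : ℝ) ^ θ := (one_mul _).symm
        _ ≤ ε * Real.log ((rad a b c : ℕ) : ℝ) ^ (1 - θ) * Real.log ((rad a b c : ℕ) : ℝ) ^ θ :=
            mul_le_mul_of_nonneg_right h1 (Real.rpow_nonneg hlog0 _)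
    have hexp : Real.exp (Real.log ((rad a b c : ℕ) : ℝ) ^ θ) ≤ ((rad a b c : ℕ) : ℝ) ^ ε := by
      calc Real.exp (Real.log ((rad a b c : ℕ) : ℝ) ^ θ)
            ≤ Real.exp (ε * Real.log ((rad a b c : ℕ) : ℝ)) := Real.exp_le_exp.mpr hθle
        _ = ((rad a b c : ℕ) : ℝ) ^ ε := by rw [Real.rpow_def_of_pos hrad0, mul_comm]
    calc (c : ℝ) ≤ Real.exp B * ((rad a b c : ℕ) : ℝ) * Real.exp (Real.log ((rad a b c : ℕ) : ℝ) ^ θ) := hc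
      _ ≤ Real.exp B * ((rad a b c : ℕ) : ℝ) * ((rad a b c : ℕ) : ℝ) ^ ε :=
          mul_le_mul_of_nonneg_left hexp (by positivity)
      _ = Real.exp B * 1 * ((rad a b c : ℕ) : ℝ) ^ (1 + ε) := by
          rw [Real.rpow_add hrad0, Real.rpow_one]; ring
      _ < Real.exp B * (Real.exp (Real.log (N₁ : ℝ) ^ θ) + 1) * ((rad a b c : ℕ) : ℝ) ^ (1 + ε) := by
          apply mul_lt_mul_of_pos_right _ hpowpos
          apply mul_lt_mul_of_pos_left _ hEB
          linarith [Real.exp_pos (Real.log (N₁ : ℝ) ^ θ)]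
  · -- small radical: `exp((log rad)^θ) ≤ exp((log N₁)^θ)`
    have hradN : ((rad a b c : ℕ) : ℝ) ≤ (N₁ : ℝ) := by exact_mod_cast hN.le
    have hmono : Real.exp (Real.log ((rad a b c : ℕ) : ℝ) ^ θ) ≤ Real.exp (Real.log (N₁ : ℝ) ^ θ) :=
      Real.exp_le_exp.mpr (Real.rpow_le_rpow hlog0 (Real.log_le_log hrad0 hradN) hθ0)
    calc (c : ℝ) ≤ Real.exp B * ((rad a b c : ℕ) : ℝ) * Real.exp (Real.log ((rad a b c : ℕ) : ℝ) ^ θ) := hc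
      _ ≤ Real.exp B * ((rad a b c : ℕ) : ℝ) ^ (1 + ε) * Real.exp (Real.log (N₁ : ℝ) ^ θ) :=
          mul_le_mul (mul_le_mul_of_nonneg_left hpow1 hEB.le) hmono (Real.exp_pos _).le (by positivity)
      _ < Real.exp B * ((rad a b c : ℕ) : ℝ) ^ (1 + ε) * Real.exp (Real.log (N₁ : ℝ) ^ θ)
            + Real.exp B * ((rad a b c : ℕ) : ℝ) ^ (1 + ε) := lt_add_of_pos_right _ (by positivity)
      _ = Real.exp B * (Real.exp (Real.log (N₁ : ℝ) ^ θ) + 1) * ((rad a b c : ℕ) : ℝ) ^ (1 + ε) := by ring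

end Summit.ABC.ABC.Cruxes.ScaleSubmultiplicativity.Disproof
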